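/-
Copyright (c) 2026 the pub-hodgecm-mathlib formalisation cell (harness21).  Prover seat hodgecm-mathlib-LH4-p09 (g9), req620 Track A «(D-RAM) FOUR-FRAME» squad
(STAGE-1b, row (2) of the piece `f_{T₊}`, the (β₂) road (R-36) row (L-P) «populated non-pure cells are balanced»; dealer LH4-plan (g13) WORD #120 «(M4-hi) LABEL TRANSPORT OF
THE NEAR-SIMILITUDE FLIPS»; F0P3-p01 (g36) (M4-hi) COLUMN 15:08:25Z `M4HI-COLUMN.out` e873a052, `OMEGAP-TEST.out` 6e8702fd), 2026-09-04.
-/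
import Summits.HodgeConjecture.HodgeConjecture.Theorems.F0P3cDyRamLabelShellFlipCardTwo   -- ★ p861900 (LH4-p15 (g0)): (S0) `valueSetMod_smul_xPlus_eq_of_v_sub_le`; brings ★ p861154 `valueSetMod_smul_xPlus_eq_iff_exists_norm` ∕ `…_eq_of_exists_norm`, ★ №3 DEFS
import HarnessLib

/-!
# Crux `H413`, line LH4 «(D-RAM) FOUR-FRAME» — STAGE-1b, row (2), the (β₂) road (R-36), row (L-P) ∕ WORD #120 (M4-hi): «A NEAR-SIMILITUDE FLIPS THE LABEL IFF ITS SYMMETRIC PART IS A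
# NON-NORM — PROVIDED ITS ANTI-SYMMETRIC CORRECTION STAYS BELOW `2·ϖ^m`» — the per-cell arithmetic of ★ p861206 `two_mul_glueUnit_mul_left` (`2·G′ = (ν⁻¹ + ρν⁻¹)·G − B`) in the
# label currency `valueSetMod σ ϖ m (e • X₊)`: `2·g′ = 2·a·g − β`, `|β| ≤ |2|·|ϖ|^m` ⟹ `VS_m(g′•X₊) = VS_m((a·g)•X₊)`; at `m = m*` the class of `g′` is that of `g` iff `a ∈ N(Eˣ)`

Cell `hodgecm-mathlib` (D-0151), FLOOR 0, crux item H413 = `stmt-HodgeConjecture-24833`, route of record `HCCMUnconditional`; squad F0∕P3c∕LH4; lane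
`--supports stmt-HodgeConjecture-24833 --as helper` (count-neutral; pays NO tier-0 row).  THEOREMS ONLY (no `def`, no instance, no notation, no `sorry`, default heartbeats);
★-only imports; states NO law; (β₂) stays a HYPOTHESIS.  DATUM-LIGHT: `K : Type` valued in `ℤᵐ⁰` with `σ`; the census value sets `valueSetMod σ ϖ m (e • xPlus σ ϖ d)` of ★ №3 DEFS;
the class dictionary ★ p861154 at `m* = mstarOfRecord d` over the ramified datum `hD` on a complete `K`.

WHY (F0P3-p01 (g36) 15:08:25Z, the (M4-hi) COLUMN asked by this seat 15:06:34Z; ★ p861206 §2).  ★ p861206 `two_mul_glueUnit_mul_left`: under `x₀ ↦ ε·x₀` with `ε·Θε = ν` the glue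
unit moves by `2·G′ = (ν⁻¹ + ρν⁻¹)·G − (ν⁻¹ − ρν⁻¹)·(t − ρt)·κ∕c_U` — symmetric part of `ν⁻¹` times `G`, minus (anti-symmetric part of `ν⁻¹`) × (anti-symmetric part of the line
ratio `t`).  The engine (ℚ₂(i), literal 2, cells (8,4)@(10,10) and (6,4)@(8,6), every populated pure fibre): `ν₊ = Tr ν∕2` a unit with `ω_{E∕F}(ν₊) = −1`, `v(ν₋) = 6` resp. `4`,
`v(t₊) = v(t₋)`, the correction `(5b∕2)·Q` of relative valuation `6` resp. `4 ≥ a₂ = 4` (the glue modulus) — «the flip is carried by `ω(ν₊) = −1`, not by the anti-symmetric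
correction», `ω(P′) = −ω(P)` on EVERY fibre; and the reading «label = s(cell, γ)·ω_{E∕F}(t₊)» on all ℚ₂(i) literal-2 tube cells tested (`OMEGAP-TEST.out`).  THIS FILE types the
arithmetic half in the tree's label currency (no `ω`, no engine object):
* §1 `sub_mul_eq_of_two_mul_eq`, `v_sub_mul_le_of_two_mul_eq` — `2 ≠ 0`, `2·g′ = 2·a·g − β` ⟹ `g′ − a·g = −β∕2`, and `|β| ≤ |2|·|ϖ|^m ⟹ |g′ − a·g| ≤ |ϖ|^m`.
* §2 HEAD `valueSetMod_smul_xPlus_eq_of_two_mul_eq` (ANY level `m`, `σ` isometric, `|ϖ| = exp(−1)`, `|ϖ − σϖ| = |ϖ|^d`): `2·g′ = 2·a·g − β`, `|β| ≤ |2|·|ϖ|^m` ⟹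
  `valueSetMod σ ϖ m (g′ • X₊) = valueSetMod σ ϖ m ((a·g) • X₊)` (★ p861900 (S0)).
* §3 THE FLIP DICTIONARY at `m = m*` (complete `K`, `hD`; `a`, `g` `σ`-fixed units): `valueSetMod_smul_xPlus_eq_of_two_mul_eq_of_exists_norm` (`a ∈ N(Eˣ)` ⟹ the class of `g′`
  is the class of `g` — NO flip) and `valueSetMod_smul_xPlus_ne_of_two_mul_eq_of_not_exists_norm` (`a ∉ N(Eˣ)` ⟹ the classes DIFFER — the FLIP), both through ★ p861154
  `valueSetMod_smul_xPlus_eq_iff_exists_norm` (`(a·g)·g⁻¹ = a`).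
READING (M4-hi).  With `G = jE g` the glue unit of the base vertex, `G′ = jE g′` that of its image, `ν⁻¹ + ρν⁻¹ = jE(2a)` (`a = (ν⁻¹)₊`, `ω(a) = ω(ν₊)` since `ν·ν⁻¹ = 1` is a norm
class computation the consumer does), `B = jE β`: the near-similitude `ε` REVERSES the label of every vertex of the cell iff `ω_{E∕F}(ν₊) = −1`, as soon as the anti-symmetric
correction is below `2·ϖ^{m*}` — the engine's «relative valuation ≥ a₂» clause; on the two cells of the column it holds with room `2` resp. `0`.  Populatedness (the image vertex
lies in the same cell) is ★ p861174 §3 (`smul_mem_levelSetDep_iff_of_orderUnit`); together they are the (L-P) balance of a populated non-pure cell at `d ≤ b`.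
WHAT IS NOT CLAIMED: which cells carry such an `ε` (the engine's HP-WITNESS-TABLE), the face reading «label = s·ω(t₊)» itself (LH4-p16 (g0)'s tube sockets ★ p861237), any law.
HONEST LABEL.  Count-neutral value-set algebra; nothing printed is asserted; no census law is stated; `HC_CM` is proved only modulo the 7 printed citations (2 remaining named inputs:
hLiu418 = `stmt-HodgeConjecture-24832`, h413 = `stmt-HodgeConjecture-24833`) until rung 0 closes.
## References
* [Jacobowitz1962] R. Jacobowitz, *Hermitian forms over local fields*, Amer. J. Math. 84 (1962): §4 (gluing, the glue unit).
* [Serre1979] J.-P. Serre, *Local Fields*, GTM 67 (1979): Ch. V §3 Cor. 3 (norm classes of units), Ch. XIV §3 (the norm residue symbol).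
* [Rogawski1990] J. D. Rogawski, *Automorphic Representations of Unitary Groups in Three Variables*, Ann. of Math. Stud. 123 (1990): §4.9 Prop. 4.9.1 (b) p. 55.
* [Kottwitz1986BaseChangeUnits] R. E. Kottwitz, *Base change for unit elements of Hecke algebras*, Compositio Math. 60 (1986): §1 pp. 240–241.
* [LanglandsShelstad1987] R. P. Langlands, D. Shelstad, *On the definition of transfer factors*, Math. Ann. 278 (1987): §1–§3 (κ-signs on a stable class).
-/

set_option autoImplicit false

noncomputable section

namespace Summit.HodgeConjecture.HodgeConjecture.Cruxes.H413.F0P3cDyRamNearSimilitudeLabelFlip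

open scoped Valued WithZero
open WithZero
open Literature.NumberTheory.Automorphic Literature.NumberTheory.Automorphic.UnitaryThreeFourFrame
open Summit.HodgeConjecture.HodgeConjecture.Cruxes.H413.F0P3cDyRamFourFramePieces
open Summit.HodgeConjecture.HodgeConjecture.Cruxes.H413.F0P3cDyRamConeCellFaceAxis (valueSetMod_smul_xPlus_eq_iff_exists_norm)
open Summit.HodgeConjecture.HodgeConjecture.Cruxes.H413.F0P3cDyRamLabelShellFlipCardTwo (valueSetMod_smul_xPlus_eq_of_v_sub_le)

variable {K : Type} [Field K] [Valued K ℤᵐ⁰]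

/-! ## §1 The arithmetic of `2·g′ = 2·a·g − β` -/

omit [Valued K ℤᵐ⁰] in
/-- `2 ≠ 0`, `2·g′ = 2·a·g − β` ⟹ `g′ − a·g = −(β∕2)`. [cite: Jacobowitz1962, §4] -/
theorem sub_mul_eq_of_two_mul_eq (h2 : (2 : K) ≠ 0) {g g' a β : K} (h : 2 * g' = 2 * a * g - β) : g' - a * g = -(β / 2) := by
  field_simp
  linear_combination h

/-- `2 ≠ 0`, `2·g′ = 2·a·g − β`, `|β| ≤ |2|·|ϖ|^m` ⟹ `|g′ − a·g| ≤ |ϖ|^m`. [cite: Jacobowitz1962, §4] [cite: Serre1979, Ch. V §3 Cor. 3] -/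
theorem v_sub_mul_le_of_two_mul_eq (h2 : (2 : K) ≠ 0) {g g' a β ϖ : K} {m : ℕ} (h : 2 * g' = 2 * a * g - β)
    (hβ : Valued.v β ≤ Valued.v (2 : K) * Valued.v ϖ ^ m) : Valued.v (g' - a * g) ≤ Valued.v ϖ ^ m := by
  have h2v : (0 : ℤᵐ⁰) < Valued.v (2 : K) := zero_lt_iff.2 ((Valuation.ne_zero_iff _).2 h2)
  rw [sub_mul_eq_of_two_mul_eq h2 h, Valuation.map_neg, map_div₀, div_le_iff₀ h2v, mul_comm]
  exact hβ

/-! ## §2 HEAD — the class of the image scalar is the class of `a·g` -/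

/-- **HEAD — «THE NEAR-SIMILITUDE MOVES THE LABEL SCALAR TO `a·g` MODULO `ϖ^m`».**  `σ` isometric, `|ϖ| = exp(−1)`, `|ϖ − σϖ| = |ϖ|^d`; `2 ≠ 0`; `2·g′ = 2·a·g − β` with the
anti-symmetric correction `|β| ≤ |2|·|ϖ|^m` ⟹ `valueSetMod σ ϖ m (g′ • X₊) = valueSetMod σ ϖ m ((a·g) • X₊)` (★ p861900 (S0) at `|g′ − a·g| ≤ |ϖ|^m`).  Read at ★ p861206
`two_mul_glueUnit_mul_left`: `a = (ν⁻¹)₊`, `β` = the `(ν⁻¹ − ρν⁻¹)·(t − ρt)·κ∕c_U` term. [cite: Jacobowitz1962, §4] [cite: Rogawski1990, §4.9 Prop. 4.9.1 (b) p. 55]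
[cite: Kottwitz1986BaseChangeUnits, §1 pp. 240–241] -/
theorem valueSetMod_smul_xPlus_eq_of_two_mul_eq {σ : K →+* K} (hvσ : ∀ a, Valued.v (σ a) = Valued.v a) {ϖ : K} (hϖ : Valued.v ϖ = exp (-1 : ℤ)) {d : ℕ}
    (hd : Valued.v (ϖ - σ ϖ) = Valued.v ϖ ^ d) (m : ℕ) (h2 : (2 : K) ≠ 0) {g g' a β : K} (h : 2 * g' = 2 * a * g - β)
    (hβ : Valued.v β ≤ Valued.v (2 : K) * Valued.v ϖ ^ m) :
    valueSetMod σ ϖ m (g' • xPlus σ ϖ d) = valueSetMod σ ϖ m ((a * g) • xPlus σ ϖ d) :=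
  valueSetMod_smul_xPlus_eq_of_v_sub_le hvσ hϖ hd m (v_sub_mul_le_of_two_mul_eq h2 h hβ)

/-! ## §3 The flip dictionary at the level of record -/

/-- **NO FLIP WHEN THE SYMMETRIC PART IS A NORM.**  Complete `K`, the ramified datum `hD`; `a`, `g` `σ`-fixed units, `a ∈ N(Eˣ)`; `2·g′ = 2·a·g − β`, `|β| ≤ |2|·|ϖ|^{m*}` ⟹
`valueSetMod σ ϖ m* (g′ • X₊) = valueSetMod σ ϖ m* (g • X₊)` (§2 + ★ p861154 `valueSetMod_smul_xPlus_eq_iff_exists_norm`: `(a·g)·g⁻¹ = a`).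
[cite: Serre1979, Ch. V §3 Cor. 3] [cite: LanglandsShelstad1987, §1–§3] -/
theorem valueSetMod_smul_xPlus_eq_of_two_mul_eq_of_exists_norm [IsAdicComplete 𝓂[K] 𝒪[K]] {σ : K →+* K} {ϖ : K} {d t : ℕ} (hD : IsRamifiedQuadraticDatum σ ϖ d t)
    (h2 : (2 : K) ≠ 0) {g g' a β : K} (hσa : σ a = a) (ha1 : Valued.v a = 1) (hσg : σ g = g) (hg1 : Valued.v g = 1)
    (h : 2 * g' = 2 * a * g - β) (hβ : Valued.v β ≤ Valued.v (2 : K) * Valued.v ϖ ^ mstarOfRecord d) (ha : ∃ z : K, z * σ z = a) :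
    valueSetMod σ ϖ (mstarOfRecord d) (g' • xPlus σ ϖ d) = valueSetMod σ ϖ (mstarOfRecord d) (g • xPlus σ ϖ d) := by
  obtain ⟨-, hvσ, hϖ, -, hdd, -, -⟩ := id hD
  rw [valueSetMod_smul_xPlus_eq_of_two_mul_eq hvσ hϖ hdd _ h2 h hβ]
  have hg0 : g ≠ 0 := fun h0 => by rw [h0, map_zero] at hg1; exact zero_ne_one hg1
  refine (valueSetMod_smul_xPlus_eq_iff_exists_norm hD (by rw [map_mul, hσa, hσg]) (by rw [Valuation.map_mul, ha1, hg1, mul_one]) hσg hg1).2 ?_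
  rw [mul_inv_cancel_right₀ hg0]; exact ha

/-- **THE FLIP WHEN THE SYMMETRIC PART IS A NON-NORM.**  Complete `K`, `hD`; `a`, `g` `σ`-fixed units, `a ∉ N(Eˣ)`; `2·g′ = 2·a·g − β`, `|β| ≤ |2|·|ϖ|^{m*}` ⟹
`valueSetMod σ ϖ m* (g′ • X₊) ≠ valueSetMod σ ϖ m* (g • X₊)` — the near-similitude REVERSES the label class (the engine's «`ω(P′) = −ω(P)` on every fibre, carried by `ω(ν₊) = −1`»).
[cite: Serre1979, Ch. V §3 Cor. 3] [cite: LanglandsShelstad1987, §1–§3] [cite: Kottwitz1986BaseChangeUnits, §1 pp. 240–241] -/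
theorem valueSetMod_smul_xPlus_ne_of_two_mul_eq_of_not_exists_norm [IsAdicComplete 𝓂[K] 𝒪[K]] {σ : K →+* K} {ϖ : K} {d t : ℕ} (hD : IsRamifiedQuadraticDatum σ ϖ d t)
    (h2 : (2 : K) ≠ 0) {g g' a β : K} (hσa : σ a = a) (ha1 : Valued.v a = 1) (hσg : σ g = g) (hg1 : Valued.v g = 1)
    (h : 2 * g' = 2 * a * g - β) (hβ : Valued.v β ≤ Valued.v (2 : K) * Valued.v ϖ ^ mstarOfRecord d) (ha : ¬ ∃ z : K, z * σ z = a) :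
    valueSetMod σ ϖ (mstarOfRecord d) (g' • xPlus σ ϖ d) ≠ valueSetMod σ ϖ (mstarOfRecord d) (g • xPlus σ ϖ d) := by
  obtain ⟨-, hvσ, hϖ, -, hdd, -, -⟩ := id hD
  rw [valueSetMod_smul_xPlus_eq_of_two_mul_eq hvσ hϖ hdd _ h2 h hβ]
  have hg0 : g ≠ 0 := fun h0 => by rw [h0, map_zero] at hg1; exact zero_ne_one hg1
  intro hEq
  have hn := (valueSetMod_smul_xPlus_eq_iff_exists_norm hD (by rw [map_mul, hσa, hσg]) (by rw [Valuation.map_mul, ha1, hg1, mul_one]) hσg hg1).1 hEq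
  rw [mul_inv_cancel_right₀ hg0] at hn
  exact ha hn

end Summit.HodgeConjecture.HodgeConjecture.Cruxes.H413.F0P3cDyRamNearSimilitudeLabelFlip

end
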